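import Summits.HodgeConjecture.CorCM.MumfordTateRankSevenSemisimple
import Summits.HodgeConjecture.CorCM.MumfordTateRankSevenSplitHodge
import Summits.HodgeConjecture.CorCM.MumfordTateRankSevenRankOne
import HarnessLib

/-!
# The rung `dim MT(H¹(X)) = 7` of the Mumford–Tate rank ladder for complex abelian varieties NOT of CM type: the trichotomy

COR-CM (cell `pub-hodgecm2`, seat `b27` gen 39, count-neutral lane MT-RANK-SEVEN-SPLIT; theorems only, no definition,
no new named fact; nothing here uses or asserts HC_CM).  Assembly of `CorCM/MumfordTateRankSevenRankOne` (gen 38: semisimple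
rank one, `Hg = SL₂ · T³`) with `CorCM/MumfordTateRankSeven{Semisimple,SplitHodge}` (this lane: semisimple `Lie Hg` of dimension
`6`).

For `X` not of CM type with `dim MT(H¹X) = 7`, gen 36 (`center_derived_of_mtRank_hodge_one_eq_seven`) leaves exactly two
Lie shapes `(dim 𝔷, dim 𝔡) ∈ {(3, 3), (0, 6)}` for the centre `𝔷` and the derived algebra `𝔡` of `Lie Hg(H¹X)`; hence

* **`mtRank_hodge_one_eq_seven_trichotomy`** — EXACTLY ONE of:
  (i) `dim [Lie Hg, Lie Hg] = 3` (`Hg = SL₂ · T³`): `X` is stably nondegenerate, or `X ∼ B^{m+1} × Z` with a Weil-type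
      degenerate CM part `Z` of MT rank `4`; the Hodge conjecture for all powers of `X` GIVEN ONLY Markman's fourfold theorem;
  (ii) `𝔷 = 0` and `Lie Hg(H¹X)` is a SIMPLE Lie algebra over `ℚ` of dimension `6` (not treated further here);
  (iii) `𝔷 = 0` and `X ∼ B₁^{a+1} × B₂^{b+1}` with `B₁ ≁ B₂` simple, not of CM type, `0 < dim Bᵢ ≤ 2`, `dim End⁰Bᵢ = dim²`,
      `Z(End⁰ Bᵢ) = ℚ`: then `X` has no factor of type IV, is stably nondegenerate with the Hodge conjecture for all its powers
      UNCONDITIONALLY when `dim B₁ = dim B₂ = 1` and GIVEN ONLY Hazama's product theorem in general.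

## References

* [MoonenZarhin1999LowDim] B. Moonen, Yu. Zarhin, *Hodge classes on abelian varieties of low dimension*, Math. Ann.
  315 (1999), §1, §2, §3 (3.1), Thm. (3.2), Cor. (3.7).
* [Deligne1982HodgeCycles] P. Deligne, *Hodge cycles on abelian varieties*, LNM 900 (1982), I §3 Prop. 3.6.
* [Humphreys1972] J. E. Humphreys, *Introduction to Lie Algebras and Representation Theory*, GTM 9 (1972), §5.2, §8.4.
* [Markman2025SecantWeil] E. Markman, *Cycles on abelian 2n-folds of Weil type from secant sheaves on abelian n-folds* (2025).
* [Hazama1989] F. Hazama, *Algebraic cycles on nonsimple abelian varieties*, Duke Math. J. 58 (1989).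
-/

noncomputable section

open scoped TensorProduct
open CategoryTheory CategoryTheory.Limits Module

namespace Summit.HodgeConjecture.CorCM

open Literature.AlgebraicGeometry.Motives
open Literature.AlgebraicGeometry.Motives.AbelianVariety
open Literature.AlgebraicGeometry.Motives.HodgeStructure
open Literature.AlgebraicGeometry.HodgeTheory
open Literature.AlgebraicGeometry.Milne1999 (IsOfCMType)

variable [HodgeTensorFacts.{0, 0}] {X : AbelianVariety ℂ} {n : ℕ}

/-- **The rung `dim MT(H¹(X)) = 7`, `X` NOT of CM type: the trichotomy.**  EXACTLY the following cases occur for a complex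
abelian variety `X` with `0 < dim X`, not of CM type, with `dim MT(H¹X) = 7`:
(i) the derived algebra of `Lie Hg(H¹X)` is three-dimensional (centre of dimension `3`, `Hg = SL₂ · T³`): then `X` is stably
nondegenerate (`B = D` on all powers, Hodge conjecture for all powers) OR `X ∼ B^{m+1} × Z` with `B` a non-CM elliptic curve /
quaternion surface and `Z` of CM type, `0 < dim Z`, `dim MT(H¹Z) = 4`, `Z` NOT stably nondegenerate (Weil type); in either
sub-case the Hodge conjecture holds for every power of `X` GIVEN ONLY Markman's theorem on Weil classes of abelian fourfolds;
(ii) the centre of `Lie Hg(H¹X)` vanishes and `Lie Hg(H¹X)` is a SIMPLE Lie algebra over `ℚ` (of dimension `6`);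
(iii) the centre vanishes and `X ∼ B₁^{a+1} × B₂^{b+1}` with `B₁`, `B₂` simple, not of CM type, `0 < dim Bᵢ ≤ 2`,
`dim_ℚ End⁰(Bᵢ) = (dim Bᵢ)²`, `Z(End⁰ Bᵢ) = ℚ`, `Hom(B₁, B₂) = 0 = Hom(B₂, B₁)`, `B₁ ≁ B₂`: then `X` has no factor of type IV,
and `X` is stably nondegenerate with the Hodge conjecture for all its powers — UNCONDITIONALLY if `dim B₁ = dim B₂ = 1`, and
GIVEN ONLY `Hazama1989_stablyNondegenerate_prod` in general.
[cite: MoonenZarhin1999LowDim, §1, §2, §3 (3.1), Thm. (3.2) and Cor. (3.7)] [cite: Deligne1982HodgeCycles, I §3 Prop. 3.6]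
[cite: Humphreys1972, §5.2 and §8.4] -/
theorem mtRank_hodge_one_eq_seven_trichotomy (hX : IsSmoothProjective n X.X) (h0 : 0 < X.dim) (hcm : ¬ IsOfCMType X)
    (h7 : haveI := BettiUniverse.finite hX 1
      (BettiUniverse.hodge exists_isReal_hodgeModel_holds hX 1).mtRank = 7) :
    haveI := BettiUniverse.finite hX 1
    letI : LieRing (Module.End ℚ (bettiCohomology X.X 1)) := LieRing.ofAssociativeRing
    (Module.finrank ℚ ↥(Submodule.span ℚ {B | ∃ X' ∈ (BettiUniverse.hodge exists_isReal_hodgeModel_holds hX 1).hodgeLie,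
        ∃ Y ∈ (BettiUniverse.hodge exists_isReal_hodgeModel_holds hX 1).hodgeLie, X' * Y - Y * X' = B}) = 3 ∧
      (IsStablyNondegenerate X ∨
        ∃ (B Z : AbelianVariety ℂ) (m : ℕ), B.IsSimple ∧ 0 < B.dim ∧ B.dim ≤ 2 ∧ ¬ IsOfCMType B ∧
          Module.finrank ℚ B.endAlgebra = B.dim ^ 2 ∧ IsOfCMType Z ∧ IsIsogenous X ((B.powSucc m).prod Z) ∧
          (m + 1) * B.dim + Z.dim = X.dim ∧ 0 < Z.dim ∧
          (haveI := BettiUniverse.finite (AbelianVariety.isSmoothProjective_holds (A := Z)) 1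
           (BettiUniverse.hodge exists_isReal_hodgeModel_holds (AbelianVariety.isSmoothProjective_holds (A := Z)) 1).mtRank = 4) ∧
          ¬ ∀ N : ℕ, IsDivisorGenerated (Z.powSucc N)) ∧
      (Markman2025_weilClasses_algebraic_abelianFourfold → ∀ N : ℕ, HodgeConjectureFor (X.powSucc N).dim (X.powSucc N).X)) ∨
    ((BettiUniverse.hodge exists_isReal_hodgeModel_holds hX 1).hodgeLie ⊓
        Subalgebra.toSubmodule (BettiUniverse.hodge exists_isReal_hodgeModel_holds hX 1).endAlg = ⊥ ∧
      ∀ 𝔏 : LieSubalgebra ℚ (Module.End ℚ (bettiCohomology X.X 1)),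
        𝔏.toSubmodule = (BettiUniverse.hodge exists_isReal_hodgeModel_holds hX 1).hodgeLie → LieAlgebra.IsSimple ℚ 𝔏) ∨
    ((BettiUniverse.hodge exists_isReal_hodgeModel_holds hX 1).hodgeLie ⊓
        Subalgebra.toSubmodule (BettiUniverse.hodge exists_isReal_hodgeModel_holds hX 1).endAlg = ⊥ ∧
      ∃ (B₁ B₂ : AbelianVariety ℂ) (a b : ℕ), B₁.IsSimple ∧ B₂.IsSimple ∧ 0 < B₁.dim ∧ B₁.dim ≤ 2 ∧ 0 < B₂.dim ∧
        B₂.dim ≤ 2 ∧ ¬ IsOfCMType B₁ ∧ ¬ IsOfCMType B₂ ∧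
        Module.finrank ℚ B₁.endAlgebra = B₁.dim ^ 2 ∧ Module.finrank ℚ (Subalgebra.center ℚ B₁.endAlgebra) = 1 ∧
        Module.finrank ℚ B₂.endAlgebra = B₂.dim ^ 2 ∧ Module.finrank ℚ (Subalgebra.center ℚ B₂.endAlgebra) = 1 ∧
        (∀ f : B₁ ⟶ B₂, f = 0) ∧ (∀ f : B₂ ⟶ B₁, f = 0) ∧ ¬ IsIsogenous B₁ B₂ ∧
        IsIsogenous X ((B₁.powSucc a).prod (B₂.powSucc b)) ∧ (a + 1) * B₁.dim + (b + 1) * B₂.dim = X.dim ∧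
        HasNoTypeIVFactor X ∧ IsStablyNondegenerate B₁ ∧ IsStablyNondegenerate B₂ ∧
        (B₁.dim = 1 → B₂.dim = 1 →
          IsStablyNondegenerate X ∧ ∀ N : ℕ, HodgeConjectureFor (X.powSucc N).dim (X.powSucc N).X) ∧
        (Hazama1989_stablyNondegenerate_prod →
          IsStablyNondegenerate X ∧ ∀ N : ℕ, HodgeConjectureFor (X.powSucc N).dim (X.powSucc N).X)) := by
  haveI := BettiUniverse.finite hX 1
  letI : LieRing (Module.End ℚ (bettiCohomology X.X 1)) := LieRing.ofAssociativeRing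
  rcases center_derived_of_mtRank_hodge_one_eq_seven hX h0 hcm h7 with ⟨-, h3⟩ | ⟨hz0, -⟩
  · -- (i) semisimple rank one
    left
    refine ⟨h3, ?_, fun hW4 N => hodgeConjectureFor_powSucc_of_finrank_derived_eq_three_of_mtRank_le_seven_of_markman hX hW4
      h0 h3 h7.le N⟩
    rcases isStablyNondegenerate_or_cmPart_degenerate_of_finrank_derived_eq_three_of_mtRank_le_seven hX h0 h3 h7.le with
      h | ⟨-, h⟩
    · exact Or.inl h
    · exact Or.inr h
  · -- `𝔷 = 0`: semisimple of dimension `6`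
    right
    have hz : (BettiUniverse.hodge exists_isReal_hodgeModel_holds hX 1).hodgeLie ⊓
        Subalgebra.toSubmodule (BettiUniverse.hodge exists_isReal_hodgeModel_holds hX 1).endAlg = ⊥ :=
      Submodule.finrank_eq_zero.1 hz0
    rcases isSimple_or_exists_ideal_pair_of_center_eq_bot_of_mtRank_eq_seven hX h0 hz h7 with h | ⟨𝔞, 𝔟, h𝔞, h𝔟, hI𝔞, hI𝔟,
      hcomm, hsum, h3𝔞, h3𝔟, hne𝔞, hne𝔟⟩
    · exact Or.inl ⟨hz, h⟩
    · right
      obtain ⟨B₁, B₂, a, b, hB₁s, hB₂s, hB₁0, hB₁2, hB₂0, hB₂2, hB₁cm, hB₂cm, hfin₁, hZ₁, hfin₂, hZ₂, h12, h21, hniso, hXB,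
        hdim, -, hA4, hSN₁, hSN₂, hcurves, hHaz⟩ :=
        exists_shape_and_hodge_of_ideal_pair hX h𝔞 h𝔟 hI𝔞 hI𝔟 hcomm hsum h3𝔞 h3𝔟 hne𝔞 hne𝔟
      exact ⟨hz, B₁, B₂, a, b, hB₁s, hB₂s, hB₁0, hB₁2, hB₂0, hB₂2, hB₁cm, hB₂cm, hfin₁, hZ₁, hfin₂, hZ₂, h12, h21, hniso, hXB,
        hdim, hA4, hSN₁, hSN₂, hcurves, hHaz⟩

end Summit.HodgeConjecture.CorCM

end
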